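import Summits.CriticalPhenomena.Ising3DConformalLimit.Theorems.InverseSquareTelemetryEtaBoundsFromTelemetryBarriers
import HarnessLib

/-!
# Crux `InverseSquareLaw` (stmt-CriticalPhenomena-4495), line `registered` — soft two-sided power
# bounds from a RATE-FREE telemetry bound

Route `InverseSquareTelemetry`, sub-problem `Ising3DConformalLimit`; THEOREM-ONLY helper file
(pure lattice analysis on `ℤ³`, no Ising input), `--supports stmt-CriticalPhenomena-4495`.

Write `s(x) = ∑ᵢ xᵢ²`, `Δ = latticeLaplacianZd` (six neighbours) and let `G > 0` solve `ΔG = V G`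
off the origin with `G ≤ C₁ s^{-1/2}`. The sharp a-priori bounds of
`EtaBoundsFromTelemetry.exterior_bounds` (`m s^{-p} ≤ G ≤ M s^{-p}`, `2p(2p-1) = κ`) need the Dini
rate `|sV - κ| ≤ C s^{-e}`. Here only a SOFT telemetry bound `|s V - κ| ≤ τ` far out is assumed
(what a rate-free limit `sV → κ` supplies for every `τ > 0`), and the conclusion is correspondingly
soft: for `0 < δ ≤ 1/8` and `τ ≤ min(δ(√(1+4κ) - 2δ)/2, 1/8)`,

  `m s^{-(p+δ)} ≤ G ≤ M s^{-(p-δ)}` on `{s ≥ S₀}`   (`soft_exterior_bounds`),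

and on all of `ℤ³ ∖ {0}` with other constants (`soft_powerBounds`). Proof: the pure powers
`s^{-(p∓δ)}` are super- and sub-solutions of `Δ - V` far out, since
`2(p-δ)(2(p-δ)-1) = κ - 2δ(√(1+4κ) - 2δ)` and `2(p+δ)(2(p+δ)-1) = κ + 2δ(√(1+4κ) + 2δ)` leave room
`> τ` for the lattice Taylor error `K s^{-1/2}` (`latticeLaplacianZd_rpow_neg`); the weight
`h = s^{-1/4}` is a positive supersolution (`-1/4 < -1/8 ≤ κ - τ`); the tree's `h`-transform
comparison principle `sub_le_super_of_hTransform` does the rest (boundary values on the finite shell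
`∂{s ≥ S₀} ⊆ {S₀/4 ≤ s < S₀}`, decay `G, s^{-(p+δ)} = o(s^{-1/4})`). Letting `δ → 0` these bounds
give the logarithmic decay exponent `2p = α₊(κ)` of `G` (file `…TelemetricLimitEta.lean`).
Method: Murata (1986); Pinchover (1994); Keller–Pinchover–Pogorzelski, J. Spectral Theory 10 (2020)
§4.2; all statements are elementary and tagged folklore.
-/

noncomputable section

namespace Summit.CriticalPhenomena.Ising3DConformalLimit.Theorems.TelemetricSoftBounds

open Literature.Probability.LatticeModels Finset Set Filter Topology
open Summit.CriticalPhenomena.Ising3DConformalLimit.Theorems.EtaBoundsFromTelemetry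

/-- **Soft a-priori bounds far out.** Let `G > 0` on `ℤ³ ∖ {0}`, `G ≤ C₁ s^{-1/2}`, `ΔG = V G` off
the origin, and `|s(x) V(x) - κ| ≤ τ` on `{S ≤ s}` with `κ ≥ 0`, `0 < δ ≤ 1/8`, `τ ≤ 1/8`,
`τ ≤ δ(√(1+4κ) - 2δ)/2`. Then with `p = (1 + √(1+4κ))/4` (`2p(2p-1) = κ`) there are `S₀`, `m > 0`,
`M` with `m s^{-(p+δ)} ≤ G ≤ M s^{-(p-δ)}` on `{S₀ ≤ s}` (pure-power barriers `s^{-(p∓δ)}`, weight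
`s^{-1/4}`, `sub_le_super_of_hTransform`). [folklore] -/
theorem soft_exterior_bounds {κ δ τ C₁ S : ℝ} (hκ : 0 ≤ κ) (hδ : 0 < δ) (hδ8 : δ ≤ 1 / 8)
    (hτ8 : τ ≤ 1 / 8) (hτδ : τ ≤ δ * (Real.sqrt (1 + 4 * κ) - 2 * δ) / 2)
    {G V : Site 3 → ℝ} (hGpos : ∀ x : Site 3, x ≠ 0 → 0 < G x)
    (hGup : ∀ x : Site 3, x ≠ 0 → G x ≤ C₁ * (∑ i, ((x i : ℤ) : ℝ) ^ 2) ^ (-(1 / 2 : ℝ)))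
    (hsol : ∀ x : Site 3, x ≠ 0 → latticeLaplacianZd G x = V x * G x)
    (hT : ∀ x : Site 3, S ≤ ∑ i, ((x i : ℤ) : ℝ) ^ 2 →
      |(∑ i, ((x i : ℤ) : ℝ) ^ 2) * V x - κ| ≤ τ) :
    ∃ S₀ m M : ℝ, 0 < m ∧ ∀ x : Site 3, S₀ ≤ ∑ i, ((x i : ℤ) : ℝ) ^ 2 →
      m * (∑ i, ((x i : ℤ) : ℝ) ^ 2) ^ (-((1 + Real.sqrt (1 + 4 * κ)) / 4 + δ)) ≤ G x ∧
      G x ≤ M * (∑ i, ((x i : ℤ) : ℝ) ^ 2) ^ (-((1 + Real.sqrt (1 + 4 * κ)) / 4 - δ)) := by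
  obtain ⟨s, hs⟩ : ∃ s : Site 3 → ℝ, ∀ x, s x = ∑ i, ((x i : ℤ) : ℝ) ^ 2 := ⟨_, fun _ => rfl⟩
  simp only [← hs] at hGup hT ⊢
  have hs0 : s 0 = 0 := by rw [hs]; simp
  have hstend : Tendsto s cofinite atTop := by simpa only [← hs] using tendsto_sumSq_cofinite
  set r : ℝ := Real.sqrt (1 + 4 * κ) with hr
  have hr1 : 1 ≤ r := by
    simpa only [Real.sqrt_one] using Real.sqrt_le_sqrt (show (1 : ℝ) ≤ 1 + 4 * κ by linarith)
  have hrr : r ^ 2 = 1 + 4 * κ := Real.sq_sqrt (by linarith)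
  set p : ℝ := (1 + r) / 4 with hp
  have hp2 : 1 / 2 ≤ p := by rw [hp]; linarith
  -- the two exponents `p₊ = p - δ` (upper barrier) and `p₋ = p + δ` (lower barrier)
  have hpp0 : 0 < p - δ := by linarith
  have hpm0 : 0 < p + δ := by linarith
  set Dp : ℝ := 2 * δ * (r - 2 * δ) with hDp
  set Dm : ℝ := 2 * δ * (r + 2 * δ) with hDm
  have hDp0 : 0 < Dp := by
    have : 0 < r - 2 * δ := by linarith
    rw [hDp]; positivity
  have hDpm : Dp ≤ Dm := by rw [hDp, hDm]; nlinarith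
  have hτDp : τ ≤ Dp / 4 := by rw [hDp]; linarith
  have hκpp : 2 * (p - δ) * (2 * (p - δ) - 1) = κ - Dp := by
    rw [hp, hDp]; linear_combination (1 / 4 : ℝ) * hrr
  have hκpm : 2 * (p + δ) * (2 * (p + δ) - 1) = κ + Dm := by
    rw [hp, hDm]; linear_combination (1 / 4 : ℝ) * hrr
  obtain ⟨Kp, hKp0, hLp⟩ := latticeLaplacianZd_rpow_neg hpp0
  obtain ⟨Km, hKm0, hLm⟩ := latticeLaplacianZd_rpow_neg hpm0
  obtain ⟨Kh, hKh0, hLh⟩ := latticeLaplacianZd_rpow_neg (show (0 : ℝ) < 1 / 4 by norm_num)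
  simp only [← hs] at hLp hLm hLh
  simp only [hκpp] at hLp
  simp only [hκpm] at hLm
  -- thresholds
  have hev : ∀ᶠ t : ℝ in atTop, 16 ≤ t ∧ (S ≤ t ∧ (Kh * t ^ (-(1 / 2 : ℝ)) ≤ 1 / 8 ∧
      (Kp * t ^ (-(1 / 2 : ℝ)) ≤ Dp / 2 ∧ Km * t ^ (-(1 / 2 : ℝ)) ≤ Dm / 2))) :=
    (eventually_ge_atTop 16).and ((eventually_ge_atTop S).and
      ((eventually_mul_rpow_neg_le (by norm_num) _ (by norm_num)).and
      ((eventually_mul_rpow_neg_le (by norm_num) _ (half_pos hDp0)).and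
      (eventually_mul_rpow_neg_le (by norm_num) _ (half_pos (hDp0.trans_le hDpm))))))
  obtain ⟨S₁, hS₁⟩ := Filter.eventually_atTop.1 hev
  set S₀ : ℝ := 4 * max S₁ 16 with hS₀def
  have hS₀64 : 64 ≤ S₀ := by
    have : (16 : ℝ) ≤ max S₁ 16 := le_max_right _ _
    rw [hS₀def]; linarith
  have hS₁S₀ : S₁ ≤ S₀ / 4 := by
    have : S₁ ≤ max S₁ 16 := le_max_left _ _
    rw [hS₀def]; linarith
  clear_value S₀
  clear hev hS₀def
  have adm : ∀ x : Site 3, S₀ / 4 ≤ s x → x ≠ 0 ∧ 0 < s x ∧ 1 ≤ s x ∧ 16 ≤ s x ∧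
      (κ - τ ≤ s x * V x ∧ s x * V x ≤ κ + τ) ∧
      Kh * s x ^ (-(1 / 2 : ℝ)) ≤ 1 / 8 ∧ Kp * s x ^ (-(1 / 2 : ℝ)) ≤ Dp / 2 ∧
      Km * s x ^ (-(1 / 2 : ℝ)) ≤ Dm / 2 := by
    intro x hx
    obtain ⟨h16, hS, h1, h2, h3⟩ := hS₁ (s x) (hS₁S₀.trans hx)
    have hx0 : x ≠ 0 := by
      rintro rfl
      rw [hs0] at h16
      linarith
    obtain ⟨hT1, hT2⟩ := abs_le.1 (hT x hS)
    exact ⟨hx0, by linarith, by linarith, h16, ⟨by linarith, by linarith⟩, h1, h2, h3⟩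
  obtain ⟨E, hE⟩ : ∃ E : Set (Site 3), E = {y : Site 3 | S₀ ≤ ∑ i, ((y i : ℤ) : ℝ) ^ 2} :=
    ⟨_, rfl⟩
  have hEmem : ∀ x, x ∈ E ↔ S₀ ≤ s x := fun x => by rw [hE, hs]; rfl
  have hEadm : ∀ x ∈ E ∪ zdOuterBoundary E, S₀ / 4 ≤ s x ∧ s x ≤ S₀ ∨ S₀ ≤ s x := by
    intro x hx
    rcases hx with hx | hx
    · exact Or.inr ((hEmem x).1 hx)
    · rw [hE] at hx
      obtain ⟨h1, h2⟩ := sumSq_of_mem_zdOuterBoundary hS₀64 hx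
      rw [← hs] at h1 h2
      exact Or.inl ⟨h1, h2.le⟩
  clear hE
  have hEadm' : ∀ x ∈ E ∪ zdOuterBoundary E, S₀ / 4 ≤ s x := by
    intro x hx
    rcases hEadm x hx with ⟨h, -⟩ | h
    · exact h
    · linarith
  -- (1) the weight `h = s^{-1/4}` is a positive supersolution of `Δ - V` on `E`
  have hpos : ∀ x ∈ E ∪ zdOuterBoundary E, 0 < (fun y => s y ^ (-(1 / 4 : ℝ))) x := by
    intro x hx
    have : 0 < s x := by linarith [hEadm' x hx]
    exact Real.rpow_pos_of_pos this _
  have hsuper : ∀ x ∈ E, latticeLaplacianZd (fun y => s y ^ (-(1 / 4 : ℝ))) x ≤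
      V x * (fun y => s y ^ (-(1 / 4 : ℝ))) x := by
    intro x hx
    obtain ⟨-, hsx0, hs1, hs16, ⟨hV1, -⟩, c1, -, -⟩ := adm x (hEadm' x (Or.inl hx))
    have hL := hLh x hs16
    have hpow : ∀ a b : ℝ, s x ^ a * s x ^ b = s x ^ (a + b) := fun a b =>
      (Real.rpow_add hsx0 a b).symm
    set H : ℝ := s x ^ (-(1 / 4 : ℝ) - 1) with hH
    set v : ℝ := s x ^ (-(1 / 2 : ℝ)) with hv
    have hH0 : 0 < H := Real.rpow_pos_of_pos hsx0 _
    have e2 : s x ^ (-(1 / 4 : ℝ) - 3 / 2) = v * H := by rw [hv, hH, hpow]; congr 1; ring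
    have e4 : s x ^ (-(1 / 4 : ℝ)) = s x * H := by
      calc s x ^ (-(1 / 4 : ℝ)) = s x ^ ((1 : ℝ) + (-(1 / 4 : ℝ) - 1)) := by norm_num
        _ = s x ^ (1 : ℝ) * s x ^ (-(1 / 4 : ℝ) - 1) := Real.rpow_add hsx0 _ _
        _ = s x * H := by rw [Real.rpow_one]
    rw [e2] at hL
    show latticeLaplacianZd (fun y => s y ^ (-(1 / 4 : ℝ))) x ≤ V x * s x ^ (-(1 / 4 : ℝ))
    rw [e4, show V x * (s x * H) = (s x * V x) * H by ring]
    obtain ⟨-, hL2⟩ := abs_le.1 hL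
    have f1 : H * (Kh * v) ≤ H * (1 / 8) := mul_le_mul_of_nonneg_left c1 hH0.le
    have f2 : (κ - τ) * H ≤ (s x * V x) * H := mul_le_mul_of_nonneg_right hV1 hH0.le
    have f3 : τ * H ≤ (1 / 8) * H := mul_le_mul_of_nonneg_right hτ8 hH0.le
    have f4 : 0 ≤ κ * H := mul_nonneg hκ hH0.le
    linarith [f1, f2, f3, f4, hL2]
  -- (2) `s^{-(p-δ)}` is a supersolution and `s^{-(p+δ)}` a subsolution of `Δ - V` on `E`
  have hbarp : ∀ x ∈ E, latticeLaplacianZd (fun y => s y ^ (-(p - δ))) x ≤ V x * s x ^ (-(p - δ)) := by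
    intro x hx
    obtain ⟨-, hsx0, hs1, hs16, ⟨hV1, -⟩, -, c2, -⟩ := adm x (hEadm' x (Or.inl hx))
    have hL := hLp x hs16
    have hpow : ∀ a b : ℝ, s x ^ a * s x ^ b = s x ^ (a + b) := fun a b =>
      (Real.rpow_add hsx0 a b).symm
    set Q : ℝ := s x ^ (-(p - δ) - 1) with hQ
    set v : ℝ := s x ^ (-(1 / 2 : ℝ)) with hv
    have hQ0 : 0 < Q := Real.rpow_pos_of_pos hsx0 _
    have e2 : s x ^ (-(p - δ) - 3 / 2) = v * Q := by rw [hv, hQ, hpow]; congr 1; ring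
    have e4 : s x ^ (-(p - δ)) = s x * Q := by
      calc s x ^ (-(p - δ)) = s x ^ ((1 : ℝ) + (-(p - δ) - 1)) := by congr 1; ring
        _ = s x ^ (1 : ℝ) * s x ^ (-(p - δ) - 1) := Real.rpow_add hsx0 _ _
        _ = s x * Q := by rw [Real.rpow_one]
    rw [e2] at hL
    rw [e4, show V x * (s x * Q) = (s x * V x) * Q by ring]
    obtain ⟨-, hL2⟩ := abs_le.1 hL
    have f1 : Q * (Kp * v) ≤ Q * (Dp / 2) := mul_le_mul_of_nonneg_left c2 hQ0.le
    have f2 : (κ - τ) * Q ≤ (s x * V x) * Q := mul_le_mul_of_nonneg_right hV1 hQ0.le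
    have f3 : τ * Q ≤ (Dp / 4) * Q := mul_le_mul_of_nonneg_right hτDp hQ0.le
    have f4 : 0 ≤ Dp * Q := mul_nonneg hDp0.le hQ0.le
    linarith [f1, f2, f3, f4, hL2]
  have hbarm : ∀ x ∈ E, V x * s x ^ (-(p + δ)) ≤ latticeLaplacianZd (fun y => s y ^ (-(p + δ))) x := by
    intro x hx
    obtain ⟨-, hsx0, hs1, hs16, ⟨-, hV2⟩, -, -, c3⟩ := adm x (hEadm' x (Or.inl hx))
    have hL := hLm x hs16
    have hpow : ∀ a b : ℝ, s x ^ a * s x ^ b = s x ^ (a + b) := fun a b =>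
      (Real.rpow_add hsx0 a b).symm
    set Q : ℝ := s x ^ (-(p + δ) - 1) with hQ
    set v : ℝ := s x ^ (-(1 / 2 : ℝ)) with hv
    have hQ0 : 0 < Q := Real.rpow_pos_of_pos hsx0 _
    have e2 : s x ^ (-(p + δ) - 3 / 2) = v * Q := by rw [hv, hQ, hpow]; congr 1; ring
    have e4 : s x ^ (-(p + δ)) = s x * Q := by
      calc s x ^ (-(p + δ)) = s x ^ ((1 : ℝ) + (-(p + δ) - 1)) := by congr 1; ring
        _ = s x ^ (1 : ℝ) * s x ^ (-(p + δ) - 1) := Real.rpow_add hsx0 _ _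
        _ = s x * Q := by rw [Real.rpow_one]
    rw [e2] at hL
    rw [e4, show V x * (s x * Q) = (s x * V x) * Q by ring]
    obtain ⟨hL1, -⟩ := abs_le.1 hL
    have f1 : Q * (Km * v) ≤ Q * (Dm / 2) := mul_le_mul_of_nonneg_left c3 hQ0.le
    have f2 : (s x * V x) * Q ≤ (κ + τ) * Q := mul_le_mul_of_nonneg_right hV2 hQ0.le
    have f3 : τ * Q ≤ (Dm / 4) * Q :=
      mul_le_mul_of_nonneg_right (hτDp.trans (by linarith)) hQ0.le
    have f4 : 0 ≤ Dm * Q := mul_nonneg (hDp0.le.trans hDpm) hQ0.le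
    linarith [f1, f2, f3, f4, hL1]
  -- the equation on `E`
  have hGsol : ∀ x ∈ E, latticeLaplacianZd G x = V x * G x := fun x hx =>
    hsol x (adm x (hEadm' x (Or.inl hx))).1
  have hF : {y : Site 3 | s y ≤ S₀}.Finite := by simpa only [← hs] using finite_sumSq_le S₀
  have hbdryF : ∀ y ∈ zdOuterBoundary E, y ∈ {y : Site 3 | s y ≤ S₀} ∧ S₀ / 4 ≤ s y := by
    intro y hy
    rcases hEadm y (Or.inr hy) with ⟨h1, h2⟩ | h
    · exact ⟨h2, h1⟩
    · exact absurd ((hEmem y).2 h) hy.1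
  -- (3) upper bound: `G ≤ M s^{-(p-δ)}` on `E`
  obtain ⟨M, hM0, hM⟩ := exists_le_mul_on_finite hF G (fun y => s y ^ (-(p - δ)))
  have hupper : ∀ x ∈ E, G x ≤ M * s x ^ (-(p - δ)) := by
    refine sub_le_super_of_hTransform (d := 3) (by norm_num) (E := E) (V := V) (u := G)
      (w := fun y => M * s y ^ (-(p - δ))) (h := fun y => s y ^ (-(1 / 4 : ℝ))) hpos hsuper
      (fun x hx => (hGsol x hx).symm.le) ?_ ?_ ?_
    · intro x hx
      rw [latticeLaplacianZd_const_mul]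
      calc M * latticeLaplacianZd (fun y => s y ^ (-(p - δ))) x ≤ M * (V x * s x ^ (-(p - δ))) :=
            mul_le_mul_of_nonneg_left (hbarp x hx) hM0.le
        _ = V x * (M * s x ^ (-(p - δ))) := by ring
    · intro y hy
      obtain ⟨hyF, hy4⟩ := hbdryF y hy
      obtain ⟨-, hsy0, -⟩ := adm y hy4
      exact hM y hyF (Real.rpow_pos_of_pos hsy0 _)
    · intro ε hε
      have hev' : ∀ᶠ x in cofinite, |C₁| * s x ^ (-(1 / 4 : ℝ)) ≤ ε :=
        hstend.eventually (eventually_mul_rpow_neg_le (by norm_num) |C₁| hε)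
      filter_upwards [hev'] with x hx hxE
      have hx4 : S₀ / 4 ≤ s x := hEadm' x (Or.inl hxE)
      obtain ⟨hx0, hsx0, -⟩ := adm x hx4
      have hq : 0 ≤ s x ^ (-(1 / 4 : ℝ)) := Real.rpow_nonneg hsx0.le _
      have hw0 : 0 ≤ M * s x ^ (-(p - δ)) := mul_nonneg hM0.le (Real.rpow_nonneg hsx0.le _)
      have hsplit : s x ^ (-(1 / 2 : ℝ)) = s x ^ (-(1 / 4 : ℝ)) * s x ^ (-(1 / 4 : ℝ)) := by
        rw [← Real.rpow_add hsx0]; norm_num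
      calc G x - M * s x ^ (-(p - δ)) ≤ G x := by linarith
        _ ≤ C₁ * s x ^ (-(1 / 2 : ℝ)) := hGup x hx0
        _ ≤ |C₁| * s x ^ (-(1 / 2 : ℝ)) :=
            mul_le_mul_of_nonneg_right (le_abs_self _) (Real.rpow_nonneg hsx0.le _)
        _ = |C₁| * s x ^ (-(1 / 4 : ℝ)) * s x ^ (-(1 / 4 : ℝ)) := by rw [hsplit, mul_assoc]
        _ ≤ ε * s x ^ (-(1 / 4 : ℝ)) := mul_le_mul_of_nonneg_right hx hq
  -- (4) lower bound: `m s^{-(p+δ)} ≤ G` on `E`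
  obtain ⟨M₂, hM₂0, hM₂⟩ := exists_le_mul_on_finite hF (fun y => s y ^ (-(p + δ))) G
  have hlower : ∀ x ∈ E, M₂⁻¹ * s x ^ (-(p + δ)) ≤ G x := by
    refine sub_le_super_of_hTransform (d := 3) (by norm_num) (E := E) (V := V)
      (u := fun y => M₂⁻¹ * s y ^ (-(p + δ))) (w := G)
      (h := fun y => s y ^ (-(1 / 4 : ℝ))) hpos hsuper ?_ (fun x hx => (hGsol x hx).le) ?_ ?_
    · intro x hx
      rw [latticeLaplacianZd_const_mul]
      calc V x * (M₂⁻¹ * s x ^ (-(p + δ))) = M₂⁻¹ * (V x * s x ^ (-(p + δ))) := by ring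
        _ ≤ M₂⁻¹ * latticeLaplacianZd (fun y => s y ^ (-(p + δ))) x :=
            mul_le_mul_of_nonneg_left (hbarm x hx) (inv_nonneg.2 hM₂0.le)
    · intro y hy
      obtain ⟨hyF, hy4⟩ := hbdryF y hy
      obtain ⟨hy0, -⟩ := adm y hy4
      rw [inv_mul_le_iff₀ hM₂0]
      exact hM₂ y hyF (hGpos y hy0)
    · intro ε hε
      have hq4 : 0 < p + δ - 1 / 4 := by linarith
      have hev' : ∀ᶠ x in cofinite, M₂⁻¹ * s x ^ (-(p + δ - 1 / 4)) ≤ ε :=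
        hstend.eventually (eventually_mul_rpow_neg_le hq4 M₂⁻¹ hε)
      filter_upwards [hev'] with x hx hxE
      have hx4 : S₀ / 4 ≤ s x := hEadm' x (Or.inl hxE)
      obtain ⟨hx0, hsx0, -⟩ := adm x hx4
      have hq : 0 ≤ s x ^ (-(1 / 4 : ℝ)) := Real.rpow_nonneg hsx0.le _
      have hsplit : s x ^ (-(p + δ)) = s x ^ (-(p + δ - 1 / 4)) * s x ^ (-(1 / 4 : ℝ)) := by
        rw [← Real.rpow_add hsx0]; congr 1; ring
      have hG0 := hGpos x hx0
      calc M₂⁻¹ * s x ^ (-(p + δ)) - G x ≤ M₂⁻¹ * s x ^ (-(p + δ)) := by linarith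
        _ = M₂⁻¹ * s x ^ (-(p + δ - 1 / 4)) * s x ^ (-(1 / 4 : ℝ)) := by rw [hsplit, mul_assoc]
        _ ≤ ε * s x ^ (-(1 / 4 : ℝ)) := mul_le_mul_of_nonneg_right hx hq
  refine ⟨S₀, M₂⁻¹, M, inv_pos.2 hM₂0, fun x hx => ?_⟩
  have hxE : x ∈ E := (hEmem x).2 hx
  have e1 : -((1 + r) / 4 + δ) = -(p + δ) := by rw [hp]
  have e2 : -((1 + r) / 4 - δ) = -(p - δ) := by rw [hp]
  rw [e1, e2]
  exact ⟨hlower x hxE, hupper x hxE⟩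

/-- **Soft a-priori bounds on all of `ℤ³ ∖ {0}`**: under the hypotheses of `soft_exterior_bounds`,
`c s^{-(p+δ)} ≤ G ≤ C' s^{-(p-δ)}` for every `x ≠ 0` (`p = (1 + √(1+4κ))/4`), with `0 < c` and
`0 < C'`, the finite region `{s < S₀}` being absorbed into the constants. [folklore] -/
theorem soft_powerBounds {κ δ τ C₁ S : ℝ} (hκ : 0 ≤ κ) (hδ : 0 < δ) (hδ8 : δ ≤ 1 / 8)
    (hτ8 : τ ≤ 1 / 8) (hτδ : τ ≤ δ * (Real.sqrt (1 + 4 * κ) - 2 * δ) / 2)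
    {G V : Site 3 → ℝ} (hGpos : ∀ x : Site 3, x ≠ 0 → 0 < G x)
    (hGup : ∀ x : Site 3, x ≠ 0 → G x ≤ C₁ * (∑ i, ((x i : ℤ) : ℝ) ^ 2) ^ (-(1 / 2 : ℝ)))
    (hsol : ∀ x : Site 3, x ≠ 0 → latticeLaplacianZd G x = V x * G x)
    (hT : ∀ x : Site 3, S ≤ ∑ i, ((x i : ℤ) : ℝ) ^ 2 →
      |(∑ i, ((x i : ℤ) : ℝ) ^ 2) * V x - κ| ≤ τ) :
    ∃ c C' : ℝ, 0 < c ∧ 0 < C' ∧ ∀ x : Site 3, x ≠ 0 →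
      c * (∑ i, ((x i : ℤ) : ℝ) ^ 2) ^ (-((1 + Real.sqrt (1 + 4 * κ)) / 4 + δ)) ≤ G x ∧
      G x ≤ C' * (∑ i, ((x i : ℤ) : ℝ) ^ 2) ^ (-((1 + Real.sqrt (1 + 4 * κ)) / 4 - δ)) := by
  obtain ⟨S₀, m, M, hm, hext⟩ := soft_exterior_bounds hκ hδ hδ8 hτ8 hτδ hGpos hGup hsol hT
  obtain ⟨s, hs⟩ : ∃ s : Site 3 → ℝ, ∀ x, s x = ∑ i, ((x i : ℤ) : ℝ) ^ 2 := ⟨_, fun _ => rfl⟩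
  simp only [← hs] at hext ⊢
  set pm : ℝ := (1 + Real.sqrt (1 + 4 * κ)) / 4 + δ with hpm
  set pp : ℝ := (1 + Real.sqrt (1 + 4 * κ)) / 4 - δ with hpp
  have hF : {y : Site 3 | s y ≤ S₀}.Finite := by simpa only [← hs] using finite_sumSq_le S₀
  obtain ⟨M₃, hM₃0, hM₃⟩ := exists_le_mul_on_finite hF (fun y => s y ^ (-pm)) G
  obtain ⟨M₄, hM₄0, hM₄⟩ := exists_le_mul_on_finite hF G (fun y => s y ^ (-pp))
  refine ⟨min m M₃⁻¹, max M M₄, lt_min hm (inv_pos.2 hM₃0), lt_max_of_lt_right hM₄0,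
    fun x hx => ?_⟩
  have hS1 : 1 ≤ s x := by rw [hs]; exact PerfectScreening.one_le_sum_sq hx
  have hSm : 0 < s x ^ (-pm) := Real.rpow_pos_of_pos (by linarith) _
  have hSp : 0 < s x ^ (-pp) := Real.rpow_pos_of_pos (by linarith) _
  by_cases hxS : S₀ ≤ s x
  · obtain ⟨h1, h2⟩ := hext x hxS
    constructor
    · exact le_trans (mul_le_mul_of_nonneg_right (min_le_left _ _) hSm.le) h1
    · exact h2.trans (mul_le_mul_of_nonneg_right (le_max_left _ _) hSp.le)
  · have hxF : x ∈ {y : Site 3 | s y ≤ S₀} := le_of_lt (not_le.1 hxS)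
    constructor
    · have h := hM₃ x hxF (hGpos x hx)
      calc min m M₃⁻¹ * s x ^ (-pm) ≤ M₃⁻¹ * s x ^ (-pm) :=
            mul_le_mul_of_nonneg_right (min_le_right _ _) hSm.le
        _ ≤ G x := by rw [inv_mul_le_iff₀ hM₃0]; exact h
    · exact (hM₄ x hxF hSp).trans (mul_le_mul_of_nonneg_right (le_max_right _ _) hSp.le)

end Summit.CriticalPhenomena.Ising3DConformalLimit.Theorems.TelemetricSoftBounds
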